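import Summits.MatrixMultiplication.OmegaCensus.STPPAlignedBlockFilter

/-!
# ω-census (abelian STPP census): filter N16 — the STRONG ALIGNED BLOCK LAW (kernel)

HONEST FRAMING (pub-omega census; verbatim): lottery ticket; floor = certified bounds/negative ranges.
Census BOOKKEEPING / STRUCTURE (seat pub-omega-stpp-1 gen 27, 2026-08-27), family (b2).  A necessary condition on STPP families in finite
abelian groups — a tool for EXCLUDING candidate block patterns by theorem; nothing here is progress on `ω`.

## Statement

Let `(Aᵢ, Bᵢ, Cᵢ)_{i<N}` be an STPP family (CKSU 2005 Def. 5.1, the tree's `IsSTPP`) with non-empty sets in a finite abelian group `H`, `|H| = n`,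
card vectors `(aᵢ, bᵢ, cᵢ)`; `X_k = B_k − A_k`, `Y_k = C_k − B_k`, `Z_k = C_k − A_k` (`STPPKneserFilter.lean` §2).

**Filter N16 (strong aligned block law).**  For EVERY block `i`, with no hypothesis on the block:

  `aᵢbᵢcᵢ + Σ_{k ≠ i} (a_k + b_k)·c_k ≤ n`,  `aᵢbᵢcᵢ + Σ_{k ≠ i} a_k·(b_k + c_k) ≤ n`,  `aᵢbᵢcᵢ + Σ_{k ≠ i} b_k·(a_k + c_k) ≤ n`

(`vol_add_sum_AC_BC_le`, `vol_add_sum_AB_AC_le`, `vol_add_sum_AB_BC_le`): **the volume of any one block and, for any one coordinate, the two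
difference families through that coordinate of all the other blocks fit into `H` disjointly.**  Decidable card-vector predicate `N16Dead` (three
readings) with `not_isSTPP_of_n16Dead{1,,'}`, same shape as `N8Dead` … `N15Dead`.  No divisor quantifier, no Kneser.

PROOF (`C`-reading).  Pick `e_A ∈ Aᵢ`, `e_B ∈ Bᵢ`, `x₀ = e_B − e_A ∈ Xᵢ`.
(1) ALIGNMENT (`STPPAlignedBlockFilter.lean`, `disjoint_translate_DU_BC_DU_AC`): `x₀ + y = z` with `y ∈ Y_l`, `z ∈ Z_k` is Def. 5.1 (ii) with `x = x₀`,
forcing `l = k = i`; so the translates `x₀ + Y_k` and the sets `Z_k`, `k ≠ i`, are `2(N−1)` pairwise disjoint sets of sizes `b_k c_k`, `a_k c_k`.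
(2) The full translated block sumset `F = {e_B + c − a − b : (a,b,c) ∈ Aᵢ × Bᵢ × Cᵢ}` has `aᵢbᵢcᵢ` points (TPP of block `i`, `card_image_blockSum`), misses
every `Z_k`, `k ≠ i` (pattern `(i,i,k)`, `disjoint_image_blockSum_DU` — this much is N14), AND misses every `x₀ + Y_k`, `k ≠ i`:
`e_B + c − a − b = x₀ + (c_k − b_k)` is the Def-5.1 relation `(e_A − a) + (b_k − b) + (c − c_k) = 0` of pattern `(i, k, i)`, whose two `A`-letters `e_A, a`
are both read in `Aᵢ` — so NO symmetry hypothesis is needed (`disjoint_image_blockSum_translate_DU_full`; the symmetry count of N15's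
`filter_card_mul_add_sum_le` was an unnecessary restriction).  Hence `F ⊔ (x₀ + Y_{≠i}) ⊔ Z_{≠i} ⊆ H`.  The other two readings: `stpp_rotate`.

RELATIONS.  N16 implies N15 (`STPPAlignedBlockFilter.lean`), N14 (`STPPBlockVolumeFilter.lean`) and both versions of N13 (`STPPPairDifferenceFilter.lean`)
outright — for N13-T2 at block `i`: (N16, `C`-reading) − (T2) `= cᵢ((aᵢ − 2)(bᵢ − 1) − 2) + 2·max c ≥ 0` — so the census's theorem-filter ladder of record
reads N7 ⊂ N8 ⊂ N9, N10, N11, N12, N16.  A two-block corollary: a beating pair `{(a₁,b₁,c₁),(a₂,b₂,c₂)}` (`Σ abc > n`) has every block with all sides `≥ 2`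
and at most one side `= 2` (`vol₂ > (a₂ + b₂)c₂` forces `(a₂ − 1)(b₂ − 1) > 1`, for every pair of sides of either block).

Measured bite (HOME `pub-omega-stpp-1-g27/n15/`, numbers only): ℤ₅₇ front of record (2 128 leaves, bundle parts-57b): N16 ALONE kills 1 941; alive under
N7–N12 + N16 = **33** (N13: 84, N14: 81, N15: 41; list `Z57-front-alive-strong.json`, `(2,3,3)`/`(3,2,3)`/`(3,3,2)`-dominated, `Σ abc ∈ {58, 60}`); on that
front N16 covers every N10/N13/N14/N15 kill, while N9/N11/N12 keep 31/78/146 kills of their own; GO #47 tier-L 29/29 N16-dead; ℤ₅₇ cores 21/108; the 17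
abelian logs (orders 48–57): UNSAT 1 306 / 5 588, cores 709 / 4 025; abelian `≤ 16` census: 20 / 201 INFEASIBLE items.  SOUNDNESS of the arithmetic:
0 / 568 FEASIBLE pairs, 0 / 1 984 SAT-witnessed patterns; set-level re-check of (1), (2) and the inequality on 645 SAT witness families × 6 role maps × every
`(i, e_A, e_B)`: 437 126 checks, 0 violations.

References: H. Cohn, R. Kleinberg, B. Szegedy, C. Umans, FOCS 2005 (arXiv:math/0511460), Def. 5.1.
-/

open Finset
open scoped Pointwise

namespace Summit.MatrixMultiplication.OmegaCensus.CubeNB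

open Literature.Computability.AlgebraicComplexity
open Summit.MatrixMultiplication.OmegaCensus.STPPKneser

variable {H : Type*} [AddCommGroup H] [DecidableEq H] [Fintype H] {N : ℕ} {A B C : Fin N → Finset H}

/-! ## §1 The strong aligned block law -/

section Law

omit [Fintype H] in
/-- The FULL translated block sumset `F = {e_B + c − a − b}` misses every aligned translate `x₀ + Y_k`, `k ≠ i` (`x₀ = e_B − e_A`, `e_A ∈ Aᵢ`):
pattern `(i, k, i)` of Def. 5.1 with `s' = e_A`, `s = a`. [cite: CohnKleinbergSzegedyUmans2005, Def. 5.1] -/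
theorem disjoint_image_blockSum_translate_DU_full (hS : IsSTPP A B C) (i : Fin N) {eA eB : H} (heA : eA ∈ A i) :
    Disjoint (((A i) ×ˢ ((B i) ×ˢ (C i))).image fun q : H × H × H => eB + q.2.2 - q.1 - q.2.1)
      ((DU B C (univ.erase i)).image fun y => eB - eA + y) := by
  rw [Finset.disjoint_left]
  intro w hw hw'
  obtain ⟨⟨a, b, c⟩, hq, rfl⟩ := Finset.mem_image.1 hw
  simp only [Finset.mem_product] at hq
  obtain ⟨ha, hb, hc⟩ := hq
  obtain ⟨y, hy, hyw⟩ := Finset.mem_image.1 hw'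
  obtain ⟨k, hk, hyk⟩ := Finset.mem_biUnion.1 hy
  obtain ⟨bk, hbk, ck, hck, rfl⟩ := mem_D.1 hyk
  have hrel : (eA - a) + (bk - b) + (c - ck) = 0 := by
    have h' := sub_eq_zero.2 hyw
    rw [← neg_eq_zero, ← h']; abel
  obtain ⟨hik, -, -, -, -⟩ := hS i k i a ha eA heA b hb bk hbk ck hck c hc hrel
  exact (Finset.mem_erase.1 hk).1 hik.symm

/-- **N16, `C`-reading.**  For an STPP family with non-empty `A`- and `B`-sets in a finite abelian group and EVERY block `i`:
`|Aᵢ||Bᵢ||Cᵢ| + Σ_{k ≠ i} (|A_k| + |B_k|)·|C_k| ≤ |H|` — the full translated block sumset, the aligned translates `x₀ + Y_k` and the sets `Z_k` (`k ≠ i`)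
are pairwise disjoint subsets of `H`. [cite: CohnKleinbergSzegedyUmans2005, Def. 5.1] -/
theorem vol_add_sum_AC_BC_le (hS : IsSTPP A B C) (hA : ∀ i, (A i).Nonempty) (hB : ∀ i, (B i).Nonempty) (i : Fin N) :
    #(A i) * #(B i) * #(C i) + ∑ k ∈ univ.erase i, (#(A k) + #(B k)) * #(C k) ≤ Fintype.card H := by
  obtain ⟨eA, heA⟩ := hA i
  obtain ⟨eB, heB⟩ := hB i
  set F := ((A i) ×ˢ ((B i) ×ˢ (C i))).image fun q : H × H × H => eB + q.2.2 - q.1 - q.2.1 with hF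
  set T := (DU B C (univ.erase i)).image fun y => eB - eA + y with hT
  set Z := DU A C (univ.erase i) with hZ
  have hcF : #F = #(A i) * #(B i) * #(C i) := card_image_blockSum hS i eB
  have hcT : #T = ∑ k ∈ univ.erase i, #(B k) * #(C k) := by
    rw [hT, Finset.card_image_of_injective _ (add_right_injective (eB - eA)), card_DU_BC hS hA]
  have hcZ : #Z = ∑ k ∈ univ.erase i, #(A k) * #(C k) := card_DU_AC hS hB _
  have hFT : Disjoint F T := disjoint_image_blockSum_translate_DU_full hS i heA
  have hFZ : Disjoint F Z := disjoint_image_blockSum_DU hS i heB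
  have hTZ : Disjoint T Z := disjoint_translate_DU_BC_DU_AC hS i heA heB
  have hunion : #(F ∪ T ∪ Z) = #F + #T + #Z := by
    rw [Finset.card_union_of_disjoint (Finset.disjoint_union_left.2 ⟨hFZ, hTZ⟩),
      Finset.card_union_of_disjoint hFT]
  have hsum : ∑ k ∈ univ.erase i, (#(A k) + #(B k)) * #(C k) =
      ∑ k ∈ univ.erase i, (#(A k) * #(C k) + #(B k) * #(C k)) :=
    Finset.sum_congr rfl fun k _ => add_mul _ _ _
  rw [hsum, Finset.sum_add_distrib, ← hcF, ← hcZ, ← hcT]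
  calc #F + (#Z + #T) = #(F ∪ T ∪ Z) := by rw [hunion]; ring
    _ ≤ Fintype.card H := Finset.card_le_univ _

/-- **N16, `A`-reading** (the law for the rotated family `(B, C, A)`): `|Aᵢ||Bᵢ||Cᵢ| + Σ_{k ≠ i} |A_k|·(|B_k| + |C_k|) ≤ |H|` (needs non-empty `B`, `C`).
[cite: CohnKleinbergSzegedyUmans2005, Def. 5.1] -/
theorem vol_add_sum_AB_AC_le (hS : IsSTPP A B C) (hB : ∀ i, (B i).Nonempty) (hC : ∀ i, (C i).Nonempty) (i : Fin N) :
    #(A i) * #(B i) * #(C i) + ∑ k ∈ univ.erase i, #(A k) * (#(B k) + #(C k)) ≤ Fintype.card H := by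
  have h := vol_add_sum_AC_BC_le (stpp_rotate hS) hB hC i
  have e1 : #(B i) * #(C i) * #(A i) = #(A i) * #(B i) * #(C i) := by ring
  have e2 : ∑ k ∈ univ.erase i, (#(B k) + #(C k)) * #(A k) = ∑ k ∈ univ.erase i, #(A k) * (#(B k) + #(C k)) :=
    Finset.sum_congr rfl fun k _ => mul_comm _ _
  rw [e1, e2] at h
  exact h

/-- **N16, `B`-reading** (the law for the rotated family `(C, A, B)`): `|Aᵢ||Bᵢ||Cᵢ| + Σ_{k ≠ i} |B_k|·(|A_k| + |C_k|) ≤ |H|` (needs non-empty `C`, `A`).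
[cite: CohnKleinbergSzegedyUmans2005, Def. 5.1] -/
theorem vol_add_sum_AB_BC_le (hS : IsSTPP A B C) (hC : ∀ i, (C i).Nonempty) (hA : ∀ i, (A i).Nonempty) (i : Fin N) :
    #(A i) * #(B i) * #(C i) + ∑ k ∈ univ.erase i, #(B k) * (#(A k) + #(C k)) ≤ Fintype.card H := by
  have h := vol_add_sum_AC_BC_le (stpp_rotate (stpp_rotate hS)) hC hA i
  have e1 : #(C i) * #(A i) * #(B i) = #(A i) * #(B i) * #(C i) := by ring
  have e2 : ∑ k ∈ univ.erase i, (#(C k) + #(A k)) * #(B k) = ∑ k ∈ univ.erase i, #(B k) * (#(A k) + #(C k)) :=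
    Finset.sum_congr rfl fun k _ => by ring
  rw [e1, e2] at h
  exact h

/-- **Two-block corollary.**  In a two-block STPP family with non-empty sets, `|A₀||B₀||C₀| + (|A₁| + |B₁|)·|C₁| ≤ |H|` (`C`-reading at block `0`).
[cite: CohnKleinbergSzegedyUmans2005, Def. 5.1] -/
theorem vol_add_pair_le_two_blocks {A B C : Fin 2 → Finset H} (hS : IsSTPP A B C) (hA : ∀ i, (A i).Nonempty)
    (hB : ∀ i, (B i).Nonempty) :
    #(A 0) * #(B 0) * #(C 0) + (#(A 1) + #(B 1)) * #(C 1) ≤ Fintype.card H := by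
  have h := vol_add_sum_AC_BC_le hS hA hB 0
  have e : (univ : Finset (Fin 2)).erase 0 = {1} := by decide
  rw [e, Finset.sum_singleton] at h
  exact h

end Law

/-! ## §2 The decidable card-vector predicate and the filter theorem -/

section Filter

/-- **Filter N16, one reading** on the card vectors: some block `i` has `aᵢbᵢcᵢ + Σ_{k≠i}(a_k + b_k)c_k > n`.  Same verdicts as HOME
`pub-omega-stpp-1-g27/code/n16_filter.py`, reading `q = C`. [folklore] -/
def N16Dead1 (n N : ℕ) (a b c : Fin N → ℕ) : Bool :=
  decide (∃ i : Fin N, n < a i * b i * c i + ∑ k ∈ univ.erase i, (a k + b k) * c k)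

/-- **Filter N16** on the card vectors: `N16Dead1` for the three rotations (readings `q = C, A, B`; the reflections give nothing new). [folklore] -/
def N16Dead (n N : ℕ) (a b c : Fin N → ℕ) : Bool := N16Dead1 n N a b c || N16Dead1 n N b c a || N16Dead1 n N c a b

/-- **Filter N16, one reading (kernel).**  An STPP family with non-empty `A`- and `B`-sets whose card vectors satisfy `N16Dead1 |H|` does not exist.
[cite: CohnKleinbergSzegedyUmans2005, Def. 5.1] -/
theorem not_isSTPP_of_n16Dead1 (hS : IsSTPP A B C) (hA : ∀ i, (A i).Nonempty) (hB : ∀ i, (B i).Nonempty) {n : ℕ}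
    (hn : Fintype.card H = n) {a b c : Fin N → ℕ} (ha : ∀ i, #(A i) = a i) (hb : ∀ i, #(B i) = b i)
    (hc : ∀ i, #(C i) = c i) (hdead : N16Dead1 n N a b c = true) : False := by
  obtain ⟨i, hlt⟩ := of_decide_eq_true hdead
  have h := vol_add_sum_AC_BC_le hS hA hB i
  rw [hn, ha, hb, hc] at h
  have e : ∑ k ∈ univ.erase i, (#(A k) + #(B k)) * #(C k) = ∑ k ∈ univ.erase i, (a k + b k) * c k :=
    Finset.sum_congr rfl fun k _ => by rw [ha, hb, hc]
  rw [e] at h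
  omega

/-- **Filter N16 (kernel): an STPP family with non-empty sets in a finite abelian group `H` whose pattern `(|Aᵢ|,|Bᵢ|,|Cᵢ|)ᵢ` is `N16Dead |H|` does not
exist** — the three readings via `stpp_rotate`. [cite: CohnKleinbergSzegedyUmans2005, Def. 5.1] -/
theorem not_isSTPP_of_n16Dead (hS : IsSTPP A B C) (hA : ∀ i, (A i).Nonempty) (hB : ∀ i, (B i).Nonempty)
    (hC : ∀ i, (C i).Nonempty) {n : ℕ} (hn : Fintype.card H = n) {a b c : Fin N → ℕ} (ha : ∀ i, #(A i) = a i)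
    (hb : ∀ i, #(B i) = b i) (hc : ∀ i, #(C i) = c i) (hdead : N16Dead n N a b c = true) : False := by
  simp only [N16Dead, Bool.or_eq_true] at hdead
  rcases hdead with (h | h) | h
  · exact not_isSTPP_of_n16Dead1 hS hA hB hn ha hb hc h
  · exact not_isSTPP_of_n16Dead1 (stpp_rotate hS) hB hC hn hb hc ha h
  · exact not_isSTPP_of_n16Dead1 (stpp_rotate (stpp_rotate hS)) hC hA hn hc ha hb h

/-- Card-vector form with literal vectors: non-emptiness from positivity of the entries. [cite: CohnKleinbergSzegedyUmans2005, Def. 5.1] -/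
theorem not_isSTPP_of_n16Dead' (hS : IsSTPP A B C) {n : ℕ} (hn : Fintype.card H = n) (a b c : Fin N → ℕ)
    (ha : ∀ i, #(A i) = a i) (hb : ∀ i, #(B i) = b i) (hc : ∀ i, #(C i) = c i)
    (hpos : ∀ i, 0 < a i ∧ 0 < b i ∧ 0 < c i) (hdead : N16Dead n N a b c = true) : False :=
  not_isSTPP_of_n16Dead hS (fun i => card_pos.1 ((ha i).symm ▸ (hpos i).1))
    (fun i => card_pos.1 ((hb i).symm ▸ (hpos i).2.1)) (fun i => card_pos.1 ((hc i).symm ▸ (hpos i).2.2))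
    hn ha hb hc hdead

end Filter

/-! ## §3 Examples -/

section Examples

/-- A leaf of the ℤ₅₇ front alive under every filter N7–N15, `{(1,1,6), (2,2,4), (3,3,2), (3,3,2)}` (`Σ abc = 58 > 57`), carries no STPP family in any
abelian group of order `57`: N16 at a `(3,3,2)` block, `C`-reading: `18 + (1+1)·6 + (2+2)·4 + (3+3)·2 = 58 > 57`. [cite: CohnKleinbergSzegedyUmans2005, Def. 5.1] -/
theorem no_isSTPP_Z57_116_224_332_332 (hH : Fintype.card H = 57) (A B C : Fin 4 → Finset H) (hS : IsSTPP A B C)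
    (hA : ∀ i, #(A i) = ![1, 2, 3, 3] i) (hB : ∀ i, #(B i) = ![1, 2, 3, 3] i) (hC : ∀ i, #(C i) = ![6, 4, 2, 2] i) :
    False :=
  not_isSTPP_of_n16Dead' hS hH _ _ _ hA hB hC (by decide) (by decide +kernel)

/-- Another such leaf with a thin `(1,2,5)` block: `{(1,2,5), (3,2,2), (3,2,3), (3,3,2)}` (`Σ abc = 58`) — N16 at the `(3,3,2)` block, `C`-reading:
`18 + (1+2)·5 + (3+2)·2 + (3+2)·3 = 18 + 15 + 10 + 15 = 58 > 57`. [cite: CohnKleinbergSzegedyUmans2005, Def. 5.1] -/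
theorem no_isSTPP_Z57_125_322_323_332 (hH : Fintype.card H = 57) (A B C : Fin 4 → Finset H) (hS : IsSTPP A B C)
    (hA : ∀ i, #(A i) = ![1, 3, 3, 3] i) (hB : ∀ i, #(B i) = ![2, 2, 2, 3] i) (hC : ∀ i, #(C i) = ![5, 2, 3, 2] i) :
    False :=
  not_isSTPP_of_n16Dead' hS hH _ _ _ hA hB hC (by decide) (by decide +kernel)

end Examples

end Summit.MatrixMultiplication.OmegaCensus.CubeNB
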